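import Summits.RiemannHypothesis.RiemannHypothesis.Theorems.ScrewPolyaSignsPolyaLandauRefutationB
import HarnessLib

/-!
# `ScrewPolyaSigns.PolyaLandau` (stmt-RiemannHypothesis-24181) is FALSE as typed — a thin dipole train

Witness (memo POLYA-DIPOLE-NOTE.md a4474ad9b7ab5cd8 §1, rh-idea-3 g4; critic idea-crit-1 and referee ref g11
reads of record): in `t = log x`, at every integer `k ≥ 1` a dipole of height `e^{3k}` and half-width
`δ_k = e^{-2k}/4`: `g = +e^{3k}` on `[e^{k-δ_k}, e^k)`, `g = -e^{3k}` on `[e^k, e^{k+δ_k})`, `0` elsewhere.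
With `σ₁ = 2`, `a = 0`, `D = B = 2`, `W₀ = {re s > -1/2}` every hypothesis holds, yet `g·x^{-3/2}` is not
integrable on `(1, ∞)` (each positive half-dipole contributes `≥ 1/8`).  The continuation `Φ` is NOT built
by an `M`-test: with the tent train `h` (`h = e^{3k}(δ_k - |log x - k|)` on the `k`-th block, `0` elsewhere,
so that `x·h' = g`) one has `∫_1^∞ g x^{-(s+1)} dx = s ∫_1^∞ h x^{-(s+1)} dx` for `re s > 2` (fundamental
theorem of calculus on each block, the boundary terms vanish because `h` does at the block ends), and
`∫_1^∞ h x^{-(s+1)} dx` converges absolutely for `re s > -1` (mass of the `k`-th tent `≍ e^{-k}`), hence is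
holomorphic there by the tree's `Landau.differentiableOn_mellinIoi`; `Φ(s) := s · mellinIoi h s`.
Sign-change sparsity does not see thin dipoles.  RH-free; standard axioms.  NEGATIVE KNOWLEDGE: blocks every
strip-form Pólya filing of this shape (repair of record: `PolyaLandauTame`, Θ-anchored sup-tame Pólya); nothing
here bears on the truth of RH.
-/

-- D-0017: `Summit.RiemannHypothesis.RiemannHypothesis.…` duplicates the namespace BY DESIGN (single-problem summit).
set_option linter.dupNamespace false

noncomputable section

open Set Filter MeasureTheory Complex
open Literature.NumberTheory.LFunctions

namespace Summit.RiemannHypothesis.RiemannHypothesis.Theorems.ScrewPolyaSignsRefutation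

/-- The continuation domain `W₀ = {re s > -1/2}`. -/
def W₀ : Set ℂ := {s | -1 / 2 < s.re}

/-- The continuation `Φ(s) = s · mellinIoi h s`. -/
def Φ (s : ℂ) : ℂ := s * Landau.mellinIoi h s

/-- `W₀` is open. -/
theorem W₀_open : IsOpen W₀ := isOpen_lt continuous_const Complex.continuous_re

/-- `W₀` is convex. -/
theorem W₀_convex : Convex ℝ W₀ :=
  convex_halfSpace_gt (IsLinearMap.mk Complex.add_re fun c x ↦ by simp) _

/-- `Φ` is holomorphic on `{re s > 2} ∪ W₀ = W₀`. -/
theorem Φ_differentiableOn : DifferentiableOn ℂ Φ ({s : ℂ | (2 : ℝ) < s.re} ∪ W₀) := by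
  have hm : DifferentiableOn ℂ (Landau.mellinIoi h) W₀ :=
    Landau.differentiableOn_mellinIoi h_measurable integrable_h
  have : DifferentiableOn ℂ Φ W₀ := differentiableOn_id.mul hm
  refine this.mono (union_subset (fun s hs ↦ ?_) subset_rfl)
  simp only [W₀, mem_setOf_eq] at hs ⊢
  linarith

/-- `Φ = mellinIoi g` on `re s > 2`. -/
theorem Φ_eqOn : EqOn Φ (Landau.mellinIoi g) {s : ℂ | (2 : ℝ) < s.re} :=
  fun _ hs ↦ mellin_identity hs

/-- The box `{0 < re ≤ 3, |im| ≤ 2π}` lies in `W₀`. -/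
theorem box_subset : {s : ℂ | (0 : ℝ) < s.re ∧ s.re ≤ 2 + 1 ∧ |s.im| ≤ Real.pi * 2} ⊆ W₀ :=
  fun s hs ↦ by simp only [W₀, mem_setOf_eq]; linarith [hs.1]

/-! ### The chain bound: alternating chains have length `≤ 2 log X + 2` -/

/-- Block code: `2k` on the left half, `2k + 1` on the right half of the `k`-th block. -/
def code (x : ℝ) : ℤ := 2 * K x + (if x < mid (K x) then 0 else 1)

/-- Sign of `g` where nonzero: positive iff on a left half. -/
theorem g_pos_iff {x : ℝ} (hx : g x ≠ 0) : 0 < g x ↔ x < mid (K x) := by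
  obtain ⟨h1, h2, h3⟩ := of_g_ne_zero hx
  rcases lt_or_ge x (mid (K x)) with hlt | hge
  · rw [g_left h1 h2 hlt]  -- K (x) = K x : uses K_eq inside g_left with k = K x
    exact ⟨fun _ ↦ hlt, fun _ ↦ Real.exp_pos _⟩
  · rw [g_right h1 hge h3]
    constructor
    · intro h; linarith [Real.exp_pos (3 * (K x : ℝ))]
    · intro h; exact absurd h (not_lt.mpr hge)

/-- The code is monotone along increasing points of the support. -/
theorem code_le_code {x y : ℝ} (hx : g x ≠ 0) (hy : g y ≠ 0) (hxy : x < y) : code x ≤ code y := by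
  obtain ⟨hx1, hx2, hx3⟩ := of_g_ne_zero hx
  obtain ⟨hy1, hy2, hy3⟩ := of_g_ne_zero hy
  have hc1 : code x ≤ 2 * K x + 1 := by unfold code; split_ifs <;> omega
  have hc2 : 2 * K y ≤ code y := by unfold code; split_ifs <;> omega
  rcases lt_trichotomy (K x) (K y) with hlt | heq | hgt
  · omega
  · unfold code
    rw [heq]
    split_ifs with h1 h2 h2
    · exact le_rfl
    · omega
    · exact absurd (hxy.trans h2) h1
    · exact le_rfl
  · have := hi_le_lo (by omega : (0 : ℤ) ≤ K y) hgt
    exact absurd ((hy3.trans_le this).trans_le hx2) (not_lt.mpr hxy.le)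

/-- Consecutive points of an alternating chain have codes differing by at least one. -/
theorem code_step {x y : ℝ} (hxy : x < y) (hsign : g x * g y < 0) : code x + 1 ≤ code y := by
  have hx : g x ≠ 0 := fun h0 ↦ by rw [h0, zero_mul] at hsign; exact lt_irrefl _ hsign
  have hy : g y ≠ 0 := fun h0 ↦ by rw [h0, mul_zero] at hsign; exact lt_irrefl _ hsign
  have hle := code_le_code hx hy hxy
  suffices code x ≠ code y by omega
  intro heq
  have hpx := g_pos_iff hx
  have hpy := g_pos_iff hy
  unfold code at heq
  rcases lt_or_gt_of_ne hx with hneg | hpos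
  · -- g x < 0 < g y
    have hgy : 0 < g y := by nlinarith
    have h1 : ¬ x < mid (K x) := fun h ↦ absurd (hpx.mpr h) (not_lt.mpr hneg.le)
    have h2 : y < mid (K y) := hpy.mp hgy
    rw [if_neg h1, if_pos h2] at heq
    omega
  · have hgy : g y < 0 := by nlinarith
    have h1 : x < mid (K x) := hpx.mp hpos
    have h2 : ¬ y < mid (K y) := fun h ↦ absurd (hpy.mpr h) (not_lt.mpr hgy.le)
    rw [if_pos h1, if_neg h2] at heq
    omega

/-- **Chain bound**: every alternating chain of `g` in `(1, X]` has length `n ≤ 2 log X + 2`. -/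
theorem chain_bound : ∀ X : ℝ, 1 ≤ X → ∀ (n : ℕ) (x : Fin (n + 1) → ℝ), StrictMono x →
    (∀ i, x i ∈ Set.Ioc 1 X) → (∀ i : Fin n, g (x i.castSucc) * g (x i.succ) < 0) →
    (n : ℝ) ≤ 2 * Real.log X + 2 := by
  intro X hX n x hmono hmem halt
  have hlog : 0 ≤ Real.log X := Real.log_nonneg hX
  rcases Nat.eq_zero_or_pos n with rfl | hn
  · simp; linarith
  -- codes increase by ≥ 1 at each step
  have hind : ∀ m : ℕ, ∀ hm : m < n + 1, code (x 0) + m ≤ code (x ⟨m, hm⟩) := by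
    intro m
    induction m with
    | zero =>
      intro hm
      have e0 : (⟨0, hm⟩ : Fin (n + 1)) = 0 := rfl
      rw [e0]; simp
    | succ m ih =>
      intro hm
      have h1 := ih (by omega)
      have h2 := code_step (hmono ((⟨m, by omega⟩ : Fin n).castSucc_lt_succ)) (halt ⟨m, by omega⟩)
      have e1 : (⟨m, by omega⟩ : Fin n).castSucc = ⟨m, by omega⟩ := Fin.ext rfl
      have e2 : (⟨m, by omega⟩ : Fin n).succ = ⟨m + 1, hm⟩ := Fin.ext rfl
      rw [e1, e2] at h2
      push_cast
      linarith
  have hlast := hind n (by omega)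
  -- the last point is in a block of index K ≥ 1 with lo K ≤ x_n ≤ X
  have hne : g (x ⟨n, by omega⟩) ≠ 0 := by
    have := halt ⟨n - 1, by omega⟩
    have e : (⟨n - 1, by omega⟩ : Fin n).succ = ⟨n, by omega⟩ := Fin.ext (by simp; omega)
    rw [e] at this
    intro h0; rw [h0, mul_zero] at this; exact lt_irrefl _ this
  have hne0 : g (x 0) ≠ 0 := by
    have := halt ⟨0, hn⟩
    have e : (⟨0, hn⟩ : Fin n).castSucc = 0 := Fin.ext rfl
    rw [e] at this
    intro h0; rw [h0, zero_mul] at this; exact lt_irrefl _ this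
  obtain ⟨hK1, hlo1, -⟩ := of_g_ne_zero hne
  obtain ⟨hK0, -, -⟩ := of_g_ne_zero hne0
  have hc0 : 2 ≤ code (x 0) := by unfold code; split_ifs <;> omega
  have hcn : code (x ⟨n, by omega⟩) ≤ 2 * K (x ⟨n, by omega⟩) + 1 := by
    unfold code; split_ifs <;> omega
  have hKle : (K (x ⟨n, by omega⟩) : ℝ) - δ (K (x ⟨n, by omega⟩)) ≤ Real.log X := by
    have h1 := Real.log_le_log (lo_pos _) (hlo1.trans (hmem _).2)
    rwa [lo, Real.log_exp] at h1
  have hδ := δ_le (show (0 : ℝ) ≤ K (x ⟨n, by omega⟩) by exact_mod_cast (by omega : (0 : ℤ) ≤ _))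
  have hint : (n : ℤ) ≤ 2 * K (x ⟨n, by omega⟩) - 1 := by omega
  have hreal : (n : ℝ) ≤ 2 * (K (x ⟨n, by omega⟩) : ℝ) - 1 := by exact_mod_cast hint
  linarith

/-! ### The refutation -/

/-- **`PolyaLandau` (stmt-RiemannHypothesis-24181) is false as typed.** Witness: the thin dipole train `g`
with `σ₁ = 2`, `a = 0`, `D = B = 2`, `W₀ = {re s > -1/2}`, `Φ(s) = s · mellinIoi h s`; the conclusion fails
at `σ = 1/2`. misstated — repaired statement of record: `PolyaLandauTame` (Θ-anchored sup-tame Pólya, K1♯). -/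
theorem not_PolyaLandau : ¬ Summit.RiemannHypothesis.RiemannHypothesis.Theses.ScrewPolyaSigns.PolyaLandau := by
  intro hP
  have := hP g 2 0 2 2 g_measurable integrable_g chain_bound (by norm_num) W₀ W₀_open W₀_convex
    box_subset Φ Φ_differentiableOn Φ_eqOn (1 / 2) (by norm_num)
  exact not_integrable_g_half this

end Summit.RiemannHypothesis.RiemannHypothesis.Theorems.ScrewPolyaSignsRefutation
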